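import Summits.QuantumFields.BalabanUV.Beta.GAN24.TaylorMassLam

/-!
# `BalabanUV.Beta.GAN24.TaylorMassVH` — binder row G-an2-4 / (CONV-C), S-slot, road «S3-Taylor» (gan24-p1 `SKELETON-S3.md` v1.0 §12.7∕§14.2):
# generic leaf **VH1**, part 1 — an1's (V-H) table `vhS`, its averaging lift and an2's BORDER INCREMENT `borderInc d Lc M κ u` in rescaled units:
# sup `3ℓ² ∕ M^{d}`, both legs within `(2(d+1)(Lc+1) + 2d + 3)·M` of the fine bond `u`, the multiplier leg ON THE `M`-COARSE LATTICE, and the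
# per-site multiplier-leg mass `≤ M · (4(d+1)(Lc+1)+4d+7)^{d+1} · 3ℓ² ∕ M^{d+1}` — i.e. the border increment at level `M` is «`M` contour terms of a
# kernel of mass `O(M^{−(d+1)})` per field site», free of everything but `(d, Lc)` once the `M^{d+2}` weight of `Sc_succ` is applied.

Engine of the idle leaf seat `b2b-balaban-gan24-formalise-leaf-11` (gen 14); row owner gan24-p1-g4 RULINGS-5 (journal l.4559) «want VH1 + L2 … file as
`GAN24/TaylorMassVH` ∕ `GAN24/TaylorMassLam`».  Part 2 (`GAN24/TaylorMassVHPush`) pushes the increment through `pushSum` (multiplier-leg fibre multiplicity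
`≤ L`).  NOT IN PRINT; OUR BOOKKEEPING.  HONEST FRAMING (cell contract, verbatim): «discharging `BetaPertH` makes Bałaban's UV stability UNCONDITIONAL — a
real constructive-QFT result; it is NOT the continuum limit and NOT the Clay problem.»  HONEST DEPENDENCY (verbatim): «continuum YM on T⁴ ⇐ BetaPertH ∧
nine spine estimates (0/9 proved); BetaPertH ⇐ (D1) ∧ (D4) ∧ CAP+tail; G-an2-4 gates asym, D1 and NE2/3/4.»  [folklore] finite combinatorics of an1's
`vhS = packVH vhKer` (printed facts `abs_vhKer_le`, `vhKer_eq_zero_left∕right`, `Near`), an2's `borderInc`∕`bshift`, an4∕an2's `avgLift` via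
`GAN24/TaylorMassLam` BY NAME; cites nothing, mints no `def … : Prop`, estimates NO resolvent leg, DISCHARGES NOTHING of rows V0∕Vt∕V, of
«E3Shape»∕«E3SupRate», of (hS, hSall) or of BetaPertH.  NOT continuum, NOT Clay.

## What is proved ([folklore], `0 sorry`; generic `d`, every `M ≥ 1`, `Lc ≥ 1`)
§1 THE (V-H) TABLE on its own lattice: `abs_vhS_le` (`|vhS d Lc κ′ u′ X Z a b| ≤ 3ℓ²`, ℓ = `ell (d+1) Lc`), `vhS_ne_zero` (only the two off-diagonal blocks; both
   sites within `2(d+1)Lc` of the background bond `u′`; the multiplier site is `Lc •` its block index).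
§2 ITS LIFT `avgLift M (mfNeg (vhS d Lc κ′ u′))`: `abs_avgLift_mfNeg_vhS_le` (`≤ 3ℓ² ∕ M^{d+1}` on every block), `avgLift_mfNeg_vhS_ne_zero` (both fine legs
   within `2(d+1)(Lc+1)·M` of `M•u′`), `avgLift_inl_inr_ne_zero_proj`∕`avgLift_inr_inl_ne_zero_proj` (a lifted multiplier leg sits on the `M`-coarse lattice).
§3 THE BORDER INCREMENT `borderInc d Lc M κ u = Σ_{s<M} avgLift M (mfNeg (vhS d Lc κ (quo M (u − s e_κ))))` (an2's `BalabanCompositeJets.l1_sub_zsmul_quo_le` BY NAME):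
   `l1_sub_zsmul_quo_bshift_le` (`|u − M•quo_M(u − s e_κ)|₁ ≤ (2d+3)M` for `s < M`), **`abs_borderInc_le`** (`≤ M · 3ℓ² ∕ M^{d+1}`), **`borderInc_ne_zero`**
   (both legs within `(2(d+1)(Lc+1) + 2d + 3)·M` of `u`; blocks ff∕mm vanish; the multiplier leg is `M`-coarse), and the MASS of the multiplier leg at a
   fixed field site: `card_filter_coarse_l1_le` (at most `(2R+1)^{d+1}` points of `M•ℤ^{d+1}` within `R·M` of a centre) and
   **`sum_abs_borderInc_inl_inr_le`** ∕ **`sum_abs_borderInc_inr_inl_le`**: `Σ_{w ∈ T} |borderInc … x w (inl α) (inr μ)| ≤ (2R_V+1)^{d+1} · M · 3ℓ² ∕ M^{d+1}`,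
   `R_V = 2(d+1)(Lc+1) + 2d + 3`, for every finite `T` and every field site `x`.
-/

noncomputable section

open Finset
open scoped BigOperators
open Literature.MathematicalPhysics.QuantumFieldTheory
open Literature.MathematicalPhysics.QuantumFieldTheory.Balaban1983to89
open Literature.MathematicalPhysics.QuantumFieldTheory.Balaban1983to89.Beta
open Literature.Probability.LatticeModels (Torus.proj Torus.proj_apply)
open LatticeForm (quo)
open B12Sec2to5 (l1 l1_nonneg)
open ExpKernelCalculus (MKer l1_natSmul l1_sub_triangle l1_sub_symm)
open OneStepResolventKernel (Fib eq_zsmul_quo_of_proj quo_zsmul proj_zsmul)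
open OneStepKernelFamily (LegIdx legSet legPt legW legW_nonneg)
open InterLevelTransport (avgLift legOff)
open StepJetData (mfNeg abs_mfNeg)
open AveragingHessianKernels (vhS vhKer packVH packVH_inl_inr packVH_inr_inl packVH_inl_inl packVH_inr_inr Near ell near_self l1_le_of_near
  vhKer_eq_zero_left vhKer_eq_zero_right abs_vhKer_le eq_smul_blk_of_off_eq_zero)
open AveragingContours (blk off)
open BalabanCompositeJets (borderInc bshift l1_bshift)
open Summit.QuantumFields.BalabanUV.Beta.GAN24.TaylorMassLam

namespace Summit.QuantumFields.BalabanUV.Beta.GAN24.TaylorMassVH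

variable {d : ℕ}

/-! ## §1 The (V-H) table on its own lattice -/

section Table

variable {Lc : ℕ}

/-- [folklore] an1's printed entry bound on the packed table: `|vhS d Lc κ′ u′ X Z a b| ≤ 3ℓ²` on every block. -/
theorem abs_vhS_le (hL : 1 ≤ Lc) (κ' : Fin (d + 1)) (u' X Z : Fin (d + 1) → ℤ) (a b : Fib d) :
    |vhS d Lc κ' u' X Z a b| ≤ 3 * (ell (d + 1) Lc : ℝ) ^ 2 := by
  have h0 : (0 : ℝ) ≤ 3 * (ell (d + 1) Lc : ℝ) ^ 2 := by positivity
  unfold vhS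
  rcases a with α | μ <;> rcases b with β | ν
  · rw [packVH_inl_inl, abs_zero]; exact h0
  · rw [packVH_inl_inr]; split_ifs
    · exact abs_vhKer_le hL _ _ _ _
    · rw [abs_zero]; exact h0
  · rw [packVH_inr_inl]; split_ifs
    · exact abs_vhKer_le hL _ _ _ _
    · rw [abs_zero]; exact h0
  · rw [packVH_inr_inr, abs_zero]; exact h0

/-- [folklore] SUPPORT OF THE (V-H) TABLE: a nonzero entry is off-diagonal, its multiplier site `Z` (resp. `X`) is the `Lc`-image of its block index, and
both sites lie within `ℓ¹`-distance `2(d+1)Lc` of the background bond `u′` (all in the units of the table's own lattice). -/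
theorem vhS_ne_zero (hL : 1 ≤ Lc) {κ' : Fin (d + 1)} {u' X Z : Fin (d + 1) → ℤ} {a b : Fib d} (h : vhS d Lc κ' u' X Z a b ≠ 0) :
    l1 (X - u') ≤ 2 * ((d : ℝ) + 1) * Lc ∧ l1 (Z - u') ≤ 2 * ((d : ℝ) + 1) * Lc ∧
      ((∃ α μ, a = Sum.inl α ∧ b = Sum.inr μ ∧ Z = (Lc : ℤ) • blk Lc Z) ∨ (∃ μ α, a = Sum.inr μ ∧ b = Sum.inl α ∧ X = (Lc : ℤ) • blk Lc X)) := by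
  unfold vhS at h
  rcases a with α | μ <;> rcases b with β | ν
  · exact absurd (packVH_inl_inl _ Lc κ' u' X Z α β) h
  · rw [packVH_inl_inr] at h
    by_cases hoff : off Lc Z = 0
    · rw [if_pos hoff] at h
      have hX : Near Lc (blk Lc Z) X := by by_contra hX; exact h (vhKer_eq_zero_left (f := (α, X)) hX _)
      have hu : Near Lc (blk Lc Z) u' := by by_contra hu; exact h (vhKer_eq_zero_right _ (f' := (κ', u')) hu)
      have hZ := eq_smul_blk_of_off_eq_zero hL hoff
      have hZn : Near Lc (blk Lc Z) Z := by
        conv => rhs; rw [hZ]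
        exact near_self hL _
      exact ⟨l1_le_of_near hX hu, l1_le_of_near hZn hu, Or.inl ⟨α, ν, rfl, rfl, hZ⟩⟩
    · exact absurd (by rw [if_neg hoff]) h
  · rw [packVH_inr_inl] at h
    by_cases hoff : off Lc X = 0
    · rw [if_pos hoff] at h
      have hZ' : Near Lc (blk Lc X) Z := by by_contra hZ'; exact h (vhKer_eq_zero_left (f := (β, Z)) hZ' _)
      have hu : Near Lc (blk Lc X) u' := by by_contra hu; exact h (vhKer_eq_zero_right _ (f' := (κ', u')) hu)
      have hX := eq_smul_blk_of_off_eq_zero hL hoff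
      have hXn : Near Lc (blk Lc X) X := by
        conv => rhs; rw [hX]
        exact near_self hL _
      exact ⟨l1_le_of_near hXn hu, l1_le_of_near hZ' hu, Or.inr ⟨μ, β, rfl, rfl, hX⟩⟩
    · exact absurd (by rw [if_neg hoff]) h
  · exact absurd (packVH_inr_inr _ Lc κ' u' X Z μ ν) h

end Table

/-! ## §2 The lifted (V-H) table -/

section Lift

variable {Lc : ℕ} (M : ℕ) [NeZero M]

omit [NeZero M] in
/-- [folklore] `ℓ¹` chaining through a dilated intermediate point: `|v − M•V|₁ ≤ A`, `|V − c|₁ ≤ B` ⇒ `|v − M•c|₁ ≤ A + M·B`. -/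
theorem l1_sub_zsmul_le_of_chain {v V c : Fin (d + 1) → ℤ} {A B : ℝ} (h1 : l1 (v - (M : ℤ) • V) ≤ A) (h2 : l1 (V - c) ≤ B) :
    l1 (v - (M : ℤ) • c) ≤ A + (M : ℝ) * B := by
  have e : (M : ℝ) * l1 (V - c) = l1 ((M : ℤ) • V - (M : ℤ) • c) := by rw [← l1_natSmul, smul_sub]
  have tri := l1_sub_triangle v ((M : ℤ) • V) ((M : ℤ) • c)
  have h3 : l1 ((M : ℤ) • V - (M : ℤ) • c) ≤ (M : ℝ) * B := by
    rw [← e]; exact mul_le_mul_of_nonneg_left h2 (Nat.cast_nonneg M)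
  linarith

omit [NeZero M] in
/-- [folklore] The leg indices behind a nonzero lifted entry, with their congruence conditions (the raw form of `exists_of_avgLift_ne_zero`). -/
theorem exists_idx_of_avgLift_ne_zero (G : MKer (d + 1) (Fib d)) {x w : Fin (d + 1) → ℤ} {a b : Fib d} (h : avgLift M G x w a b ≠ 0) :
    ∃ i ∈ legSet d M a, ∃ i' ∈ legSet d M b, Torus.proj M (x - legOff M a i) = 0 ∧ Torus.proj M (w - legOff M b i') = 0 := by
  unfold avgLift at h
  obtain ⟨i, hi, h1⟩ := Finset.exists_ne_zero_of_sum_ne_zero h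
  obtain ⟨i', hi', h2⟩ := Finset.exists_ne_zero_of_sum_ne_zero h1
  have hc : Torus.proj M (x - legOff M a i) = 0 ∧ Torus.proj M (w - legOff M b i') = 0 := by
    by_contra hc; exact h2 (by rw [if_neg hc, mul_zero])
  exact ⟨i, hi, i', hi', hc⟩

omit [NeZero M] in
/-- [folklore] **A LIFTED MULTIPLIER LEG SITS ON THE `M`-COARSE LATTICE** (second leg). -/
theorem avgLift_inr_right_ne_zero_proj (G : MKer (d + 1) (Fib d)) {x w : Fin (d + 1) → ℤ} {a : Fib d} {μ : Fin (d + 1)}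
    (h : avgLift M G x w a (Sum.inr μ) ≠ 0) : Torus.proj M w = 0 := by
  obtain ⟨-, -, i', -, -, h2⟩ := exists_idx_of_avgLift_ne_zero M G h
  simpa only [legOff, legPt, smul_zero, sub_zero] using h2

omit [NeZero M] in
/-- [folklore] **A LIFTED MULTIPLIER LEG SITS ON THE `M`-COARSE LATTICE** (first leg). -/
theorem avgLift_inr_left_ne_zero_proj (G : MKer (d + 1) (Fib d)) {x w : Fin (d + 1) → ℤ} {μ : Fin (d + 1)} {b : Fib d}
    (h : avgLift M G x w (Sum.inr μ) b ≠ 0) : Torus.proj M x = 0 := by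
  obtain ⟨i, -, -, -, h1, -⟩ := exists_idx_of_avgLift_ne_zero M G h
  simpa only [legOff, legPt, smul_zero, sub_zero] using h1

/-- [folklore] **SIZE OF THE LIFTED (V-H) TABLE**: `|avgLift M (mfNeg (vhS d Lc κ′ u′)) x w a b| ≤ 3ℓ² ∕ M^{d+1}` on every block (one lifted field leg of
weight `M^{−(d+2)}` and fibre `≤ M`, one multiplier leg of weight `1` and fibre `≤ 1`; the diagonal blocks vanish). -/
theorem abs_avgLift_mfNeg_vhS_le (hL : 1 ≤ Lc) (κ' : Fin (d + 1)) (u' x w : Fin (d + 1) → ℤ) (a b : Fib d) :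
    |avgLift M (mfNeg (vhS d Lc κ' u')) x w a b| ≤ 3 * (ell (d + 1) Lc : ℝ) ^ 2 / (M : ℝ) ^ (d + 1) := by
  have h0 : (0 : ℝ) ≤ 3 * (ell (d + 1) Lc : ℝ) ^ 2 / (M : ℝ) ^ (d + 1) := by positivity
  have hS : ∀ X Z (a b : Fib d), |mfNeg (vhS d Lc κ' u') X Z a b| ≤ 3 * (ell (d + 1) Lc : ℝ) ^ 2 := fun X Z a b => by
    rw [abs_mfNeg]; exact abs_vhS_le hL κ' u' X Z a b
  rcases a with α | μ <;> rcases b with β | ν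
  · have hz : avgLift M (mfNeg (vhS d Lc κ' u')) x w (Sum.inl α) (Sum.inl β) = 0 := by
      by_contra hne
      obtain ⟨X, W, hG, -, -⟩ := exists_of_avgLift_ne_zero M _ hne
      refine hG ?_
      rw [StepJetData.mfNeg_inl_inl]
      exact packVH_inl_inl _ Lc κ' u' X W α β
    rw [hz, abs_zero]; exact h0
  · exact abs_avgLift_inl_inr_le M _ α ν (fun X W => hS X W _ _) x w
  · exact abs_avgLift_inr_inl_le M _ μ β (fun X W => hS X W _ _) x w
  · have hz : avgLift M (mfNeg (vhS d Lc κ' u')) x w (Sum.inr μ) (Sum.inr ν) = 0 := by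
      by_contra hne
      obtain ⟨X, W, hG, -, -⟩ := exists_of_avgLift_ne_zero M _ hne
      refine hG ?_
      rw [StepJetData.mfNeg_inr_inr]
      exact packVH_inr_inr _ Lc κ' u' X W μ ν
    rw [hz, abs_zero]; exact h0

/-- [folklore] **SUPPORT OF THE LIFTED (V-H) TABLE**: both fine legs of a nonzero entry lie within `ℓ¹`-distance `2(d+1)(Lc+1)·M` of `M•u′`. -/
theorem avgLift_mfNeg_vhS_ne_zero (hL : 1 ≤ Lc) {κ' : Fin (d + 1)} {u' x w : Fin (d + 1) → ℤ} {a b : Fib d}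
    (h : avgLift M (mfNeg (vhS d Lc κ' u')) x w a b ≠ 0) :
    l1 (x - (M : ℤ) • u') ≤ 2 * ((d : ℝ) + 1) * (Lc + 1) * M ∧ l1 (w - (M : ℤ) • u') ≤ 2 * ((d : ℝ) + 1) * (Lc + 1) * M := by
  obtain ⟨X, W, hG, hx, hw⟩ := exists_of_avgLift_ne_zero M _ h
  have hG' : vhS d Lc κ' u' X W a b ≠ 0 := by
    intro h0; apply hG; have := abs_mfNeg (vhS d Lc κ' u') X W a b; rw [h0, abs_zero, abs_eq_zero] at this; exact this
  obtain ⟨hX, hW, -⟩ := vhS_ne_zero hL hG'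
  have e : ∀ {t : ℝ}, t ≤ 2 * (d + 1) * M + (M : ℝ) * (2 * ((d : ℝ) + 1) * Lc) → t ≤ 2 * ((d : ℝ) + 1) * (Lc + 1) * M :=
    fun ht => by linarith
  exact ⟨e (l1_sub_zsmul_le_of_chain M hx hX), e (l1_sub_zsmul_le_of_chain M hw hW)⟩

end Lift

/-! ## §3 The border increment -/

section Border

variable {Lc : ℕ} (M : ℕ) [NeZero M]

/-- [folklore] The contour points through `u`: `|u − M•quo_M (u − s e_κ)|₁ ≤ (2d+3)·M` for `s < M` (in fact `≤ (d+2)M`; the slack keeps it a natural). -/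
theorem l1_sub_zsmul_quo_bshift_le (κ : Fin (d + 1)) (u : Fin (d + 1) → ℤ) {s : ℕ} (hs : s < M) :
    l1 (u - (M : ℤ) • quo M (u - bshift d κ s)) ≤ (2 * (d : ℝ) + 3) * M := by
  have h1 := BalabanCompositeJets.l1_sub_zsmul_quo_le M (u - bshift d κ s)
  have tri := l1_sub_triangle u (u - bshift d κ s) ((M : ℤ) • quo M (u - bshift d κ s))
  have h2 : l1 (u - (u - bshift d κ s)) = s := by rw [show u - (u - bshift d κ s) = bshift d κ s by abel]; exact l1_bshift κ s
  have hs' : (s : ℝ) ≤ M := by exact_mod_cast hs.le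
  have hM : (0 : ℝ) ≤ M := Nat.cast_nonneg M
  nlinarith

/-- [folklore] **SIZE OF THE BORDER INCREMENT**: `|borderInc d Lc M κ u x w a b| ≤ M · (3ℓ² ∕ M^{d+1})` — `M` contour terms, each a lifted (V-H) table. -/
theorem abs_borderInc_le (hL : 1 ≤ Lc) (κ : Fin (d + 1)) (u x w : Fin (d + 1) → ℤ) (a b : Fib d) :
    |borderInc d Lc M κ u x w a b| ≤ (M : ℝ) * (3 * (ell (d + 1) Lc : ℝ) ^ 2 / (M : ℝ) ^ (d + 1)) := by
  unfold borderInc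
  refine (Finset.abs_sum_le_sum_abs _ _).trans ?_
  refine (Finset.sum_le_sum fun s _ => abs_avgLift_mfNeg_vhS_le M hL κ _ x w a b).trans ?_
  rw [Finset.sum_const, Finset.card_range, nsmul_eq_mul]

/-- [folklore] **SUPPORT OF THE BORDER INCREMENT**: both legs of a nonzero entry lie within `ℓ¹`-distance `(2(d+1)(Lc+1) + 2d + 3)·M` of the fine bond `u`. -/
theorem borderInc_ne_zero (hL : 1 ≤ Lc) {κ : Fin (d + 1)} {u x w : Fin (d + 1) → ℤ} {a b : Fib d} (h : borderInc d Lc M κ u x w a b ≠ 0) :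
    l1 (x - u) ≤ ((2 * (d + 1) * (Lc + 1) + (2 * d + 3)) * M : ℕ) ∧ l1 (w - u) ≤ ((2 * (d + 1) * (Lc + 1) + (2 * d + 3)) * M : ℕ) := by
  unfold borderInc at h
  obtain ⟨s, hs, hne⟩ := Finset.exists_ne_zero_of_sum_ne_zero h
  rw [Finset.mem_range] at hs
  obtain ⟨hx, hw⟩ := avgLift_mfNeg_vhS_ne_zero M hL hne
  have hu := l1_sub_zsmul_quo_bshift_le M κ u hs
  have hu' : l1 ((M : ℤ) • quo M (u - bshift d κ s) - u) ≤ (2 * (d : ℝ) + 3) * M := by rw [l1_sub_symm]; exact hu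
  have cast : (((2 * (d + 1) * (Lc + 1) + (2 * d + 3)) * M : ℕ) : ℝ) = 2 * ((d : ℝ) + 1) * (Lc + 1) * M + (2 * (d : ℝ) + 3) * M := by
    push_cast; ring
  rw [cast]
  constructor
  · have tri := l1_sub_triangle x ((M : ℤ) • quo M (u - bshift d κ s)) u
    linarith
  · have tri := l1_sub_triangle w ((M : ℤ) • quo M (u - bshift d κ s)) u
    linarith

omit [NeZero M] in
/-- [folklore] The multiplier leg of the border increment sits on the `M`-coarse lattice (second leg). -/
theorem borderInc_inr_right_ne_zero_proj {κ : Fin (d + 1)} {u x w : Fin (d + 1) → ℤ} {a : Fib d} {μ : Fin (d + 1)}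
    (h : borderInc d Lc M κ u x w a (Sum.inr μ) ≠ 0) : Torus.proj M w = 0 := by
  unfold borderInc at h
  obtain ⟨s, -, hne⟩ := Finset.exists_ne_zero_of_sum_ne_zero h
  exact avgLift_inr_right_ne_zero_proj M _ hne

omit [NeZero M] in
/-- [folklore] The multiplier leg of the border increment sits on the `M`-coarse lattice (first leg). -/
theorem borderInc_inr_left_ne_zero_proj {κ : Fin (d + 1)} {u x w : Fin (d + 1) → ℤ} {μ : Fin (d + 1)} {b : Fib d}
    (h : borderInc d Lc M κ u x w (Sum.inr μ) b ≠ 0) : Torus.proj M x = 0 := by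
  unfold borderInc at h
  obtain ⟨s, -, hne⟩ := Finset.exists_ne_zero_of_sum_ne_zero h
  exact avgLift_inr_left_ne_zero_proj M _ hne

/-- [folklore] **COARSE BOX COUNT**: at most `(2R+1)^{d+1}` points of the `M`-coarse lattice lie within `ℓ¹`-distance `R·M` of a given centre. -/
theorem card_filter_coarse_l1_le (T : Finset (Fin (d + 1) → ℤ)) (c : Fin (d + 1) → ℤ) (R : ℕ) :
    (T.filter fun w => Torus.proj M w = 0 ∧ l1 (w - c) ≤ ((R * M : ℕ) : ℝ)).card ≤ (2 * R + 1) ^ (d + 1) := by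
  classical
  have hM : (0 : ℤ) < M := by exact_mod_cast Nat.pos_of_ne_zero (NeZero.ne M)
  set box := Fintype.piFinset fun j : Fin (d + 1) => Finset.Icc (c j / (M : ℤ) - R) (c j / (M : ℤ) + R) with hbox
  have hmaps : ∀ w ∈ (T.filter fun w => Torus.proj M w = 0 ∧ l1 (w - c) ≤ ((R * M : ℕ) : ℝ)), quo M w ∈ box := by
    intro w hw
    rw [Finset.mem_filter] at hw
    obtain ⟨-, hproj, hl1⟩ := hw
    have ew := eq_zsmul_quo_of_proj (N := M) hproj
    rw [hbox, Fintype.mem_piFinset]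
    intro j
    rw [Finset.mem_Icc]
    have hj : |(((w - c) j : ℤ) : ℝ)| ≤ ((R * M : ℕ) : ℝ) := by
      refine le_trans ?_ hl1
      unfold B12Sec2to5.l1
      exact Finset.single_le_sum (f := fun i => |(((w - c) i : ℤ) : ℝ)|) (fun i _ => abs_nonneg _) (Finset.mem_univ j)
    have hj' : |(M : ℤ) * quo M w j - c j| ≤ (R : ℤ) * M := by
      have e1 : (w - c) j = (M : ℤ) * quo M w j - c j := by
        rw [Pi.sub_apply]; conv_lhs => rw [ew]; simp [Pi.smul_apply, smul_eq_mul]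
      rw [e1] at hj; rw [← Int.cast_abs] at hj; exact_mod_cast hj
    rw [abs_le] at hj'
    obtain ⟨h1, h2⟩ := hj'
    set q := quo M w j with hq
    set p := c j / (M : ℤ) with hp
    set r := c j % (M : ℤ) with hr
    obtain ⟨hdiv, hmod0, hmodlt⟩ := (Int.ediv_emod_unique hM).1 ⟨hp.symm, hr.symm⟩
    constructor
    · by_contra hlt
      have hlt' := not_le.mp hlt
      have h3 : (1 : ℤ) ≤ p - R - q := by omega
      have h4 : (M : ℤ) ≤ (M : ℤ) * (p - R - q) := by nlinarith
      nlinarith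
    · by_contra hlt
      have hlt' := not_le.mp hlt
      have h3 : (1 : ℤ) ≤ q - p - R := by omega
      have h4 : (M : ℤ) ≤ (M : ℤ) * (q - p - R) := by nlinarith
      nlinarith
  have hinj : Set.InjOn (quo M) ((T.filter fun w => Torus.proj M w = 0 ∧ l1 (w - c) ≤ ((R * M : ℕ) : ℝ)) : Set (Fin (d + 1) → ℤ)) := by
    intro w hw w' hw' hq
    rw [Finset.coe_filter] at hw hw'
    rw [eq_zsmul_quo_of_proj (N := M) hw.2.1, eq_zsmul_quo_of_proj (N := M) hw'.2.1, hq]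
  refine (Finset.card_le_card_of_injOn (quo M) hmaps hinj).trans ?_
  rw [hbox, Fintype.card_piFinset]
  have hc : ∀ j, (Finset.Icc (c j / (M : ℤ) - R) (c j / (M : ℤ) + R)).card = 2 * R + 1 := fun j => by rw [Int.card_Icc]; omega
  simp only [hc, Finset.prod_const, Finset.card_univ, Fintype.card_fin, le_refl]

/-- [folklore] **MULTIPLIER-LEG MASS OF THE BORDER INCREMENT AT A FIXED FIELD SITE**: for every finite `T`,
`Σ_{w ∈ T} |borderInc d Lc M κ u x w (inl α) (inr μ)| ≤ (2R_V+1)^{d+1} · M · 3ℓ² ∕ M^{d+1}`, `R_V = 2(d+1)(Lc+1) + 2d + 3` (the multiplier leg runs over the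
`M`-coarse points of an `ℓ¹`-ball of radius `R_V·M` around `u`). -/
theorem sum_abs_borderInc_inl_inr_le (hL : 1 ≤ Lc) (κ : Fin (d + 1)) (u x : Fin (d + 1) → ℤ) (α μ : Fin (d + 1))
    (T : Finset (Fin (d + 1) → ℤ)) :
    ∑ w ∈ T, |borderInc d Lc M κ u x w (Sum.inl α) (Sum.inr μ)| ≤
      ((2 * (2 * (d + 1) * (Lc + 1) + (2 * d + 3)) + 1) ^ (d + 1) : ℕ) * ((M : ℝ) * (3 * (ell (d + 1) Lc : ℝ) ^ 2 / (M : ℝ) ^ (d + 1))) := by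
  classical
  set R : ℕ := 2 * (d + 1) * (Lc + 1) + (2 * d + 3) with hR
  set T' := T.filter fun w => Torus.proj M w = 0 ∧ l1 (w - u) ≤ ((R * M : ℕ) : ℝ) with hT'
  have hsub : T' ⊆ T := Finset.filter_subset _ _
  have hvan : ∀ w ∈ T, w ∉ T' → |borderInc d Lc M κ u x w (Sum.inl α) (Sum.inr μ)| = 0 := by
    intro w hw hw'
    rw [abs_eq_zero]
    by_contra hne
    exact hw' (Finset.mem_filter.2 ⟨hw, borderInc_inr_right_ne_zero_proj M hne, (borderInc_ne_zero M hL hne).2⟩)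
  rw [← Finset.sum_subset hsub hvan]
  have hB : 0 ≤ (M : ℝ) * (3 * (ell (d + 1) Lc : ℝ) ^ 2 / (M : ℝ) ^ (d + 1)) := by positivity
  calc ∑ w ∈ T', |borderInc d Lc M κ u x w (Sum.inl α) (Sum.inr μ)|
      ≤ ∑ w ∈ T', (M : ℝ) * (3 * (ell (d + 1) Lc : ℝ) ^ 2 / (M : ℝ) ^ (d + 1)) :=
        Finset.sum_le_sum fun w _ => abs_borderInc_le M hL κ u x w _ _
    _ = (T'.card : ℝ) * ((M : ℝ) * (3 * (ell (d + 1) Lc : ℝ) ^ 2 / (M : ℝ) ^ (d + 1))) := by rw [Finset.sum_const, nsmul_eq_mul]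
    _ ≤ _ := by
        refine mul_le_mul_of_nonneg_right ?_ hB
        exact_mod_cast card_filter_coarse_l1_le M T u R

/-- [folklore] The mirror block: multiplier-leg mass at a fixed field site, summing over the FIRST leg. -/
theorem sum_abs_borderInc_inr_inl_le (hL : 1 ≤ Lc) (κ : Fin (d + 1)) (u w : Fin (d + 1) → ℤ) (μ α : Fin (d + 1))
    (S : Finset (Fin (d + 1) → ℤ)) :
    ∑ x ∈ S, |borderInc d Lc M κ u x w (Sum.inr μ) (Sum.inl α)| ≤
      ((2 * (2 * (d + 1) * (Lc + 1) + (2 * d + 3)) + 1) ^ (d + 1) : ℕ) * ((M : ℝ) * (3 * (ell (d + 1) Lc : ℝ) ^ 2 / (M : ℝ) ^ (d + 1))) := by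
  classical
  set R : ℕ := 2 * (d + 1) * (Lc + 1) + (2 * d + 3) with hR
  set S' := S.filter fun x => Torus.proj M x = 0 ∧ l1 (x - u) ≤ ((R * M : ℕ) : ℝ) with hS'
  have hsub : S' ⊆ S := Finset.filter_subset _ _
  have hvan : ∀ x ∈ S, x ∉ S' → |borderInc d Lc M κ u x w (Sum.inr μ) (Sum.inl α)| = 0 := by
    intro x hx hx'
    rw [abs_eq_zero]
    by_contra hne
    exact hx' (Finset.mem_filter.2 ⟨hx, borderInc_inr_left_ne_zero_proj M hne, (borderInc_ne_zero M hL hne).1⟩)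
  rw [← Finset.sum_subset hsub hvan]
  have hB : 0 ≤ (M : ℝ) * (3 * (ell (d + 1) Lc : ℝ) ^ 2 / (M : ℝ) ^ (d + 1)) := by positivity
  calc ∑ x ∈ S', |borderInc d Lc M κ u x w (Sum.inr μ) (Sum.inl α)|
      ≤ ∑ x ∈ S', (M : ℝ) * (3 * (ell (d + 1) Lc : ℝ) ^ 2 / (M : ℝ) ^ (d + 1)) :=
        Finset.sum_le_sum fun x _ => abs_borderInc_le M hL κ u x w _ _
    _ = (S'.card : ℝ) * ((M : ℝ) * (3 * (ell (d + 1) Lc : ℝ) ^ 2 / (M : ℝ) ^ (d + 1))) := by rw [Finset.sum_const, nsmul_eq_mul]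
    _ ≤ _ := by
        refine mul_le_mul_of_nonneg_right ?_ hB
        exact_mod_cast card_filter_coarse_l1_le M S u R

end Border

end Summit.QuantumFields.BalabanUV.Beta.GAN24.TaylorMassVH

end
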